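import Summits.QuantumAdvantage.QuantumAdvantage.Theses.CommutingDeciders
import Literature.Computability.Complexity.PromiseZPPProofs

/-!
# Line `totalize` — skeleton for the piece `CommutingDeciders.CommutingPromiseLift` (X₂)
of the split `CommutingWitness ⟸ CommutingPromiseWitness ∧ CommutingPromiseLift`
(crux item stmt-QuantumAdvantage-2639 `CommutingWitness`, route `route-QuantumAdvantage-CommutingDeciders`;
crux-strategist decomposition, 2026-08-17).

PIECE (X₂, by name after the split; defined locally below with the IDENTICAL text until the gate writes it):
`[∀ L, (L has a one-shot commuting decider, total gap) → L ∈ BPP] → ∀ Q, (Q has a one-shot commuting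
promise-decider) → Q ∈ PromiseBPP'` — the IQP-level instance of the open promise→language lift
`BQP ⊆ BPP → PromiseBQP ⊆ PromiseBPP'` (route PromiseLift's crux `PlLift`, stmt-0250; classical analogue
`BPP = P →? prBPP = prP`, Goldreich 2011 §6 fn 27; Aaronson–Arkhipov 2013 §10 (9)–(10)).  The general lift
admits no relativizing proof (tree: `Literature.Barriers.QuantumAdvantage.PromiseLiftRelativization`).

TRANSFER (why easier / what it exposes).  X₂ mixes a complexity hypothesis with a structural conclusion; its
only known non-vacuous road — exactly as for `PlLift` (`PlPromiseIsLift`, stmt-11235: "every PromiseBQP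
problem is separated by a BQP LANGUAGE") — is the HARDNESS-FREE totalization statement
  C⁺ = `stub_totalize`: every promise problem with a one-shot commuting promise-decider is SEPARATED by a
  LANGUAGE with a one-shot commuting decider (total gap): `Q.yes ⊆ L`, `Q.no ⊆ Lᶜ`.
C⁺ → X₂ by the restriction lemma `stub_restrict` (known: `PromiseBPP ⊆ PromiseBPP'`, tree
`PromiseBPP_subset_PromiseBPP'_holds`).  C⁺ is a statement about IQP circuits ALONE ("pseudo-deterministic
rounding of a one-shot {Z,CZ,T} statistic by a one-shot {Z,CZ,T} statistic"): given a sigma-uniform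
(W, D, A) whose acceptance probability `acc x` may wander through (1/3, 2/3) off the promise, produce a
sigma-uniform (W', D', A') whose acceptance probability avoids (1/3, 2/3) on EVERY input and rounds `acc`
correctly where `acc x ∉ (1/3, 2/3)`.  What it exposes: (i) the continuity obstruction — any construction
`D' = G(D_x)`, `A'` a fixed threshold of an empirical mean is continuous in `acc x` and fails on a dense
set of values, so `A'` must read `x` discontinuously (shifted/dithered rounding à la Goldreich–Ron /
Gat–Goldwasser pseudo-determinism, with the dither computed from `x`); (ii) the easy sub-cases that DO
totalize (Clifford `D_x`: `acc` is P-computable by Gottesman–Knill, take `A' = [acc x ≥ 1/2]`; T-count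
`O(log n)`: Bravyi–Gosset) — so C⁺ is open exactly on the families of super-logarithmic T-count, the
same frontier as X₁'s hard stub; (iii) C⁺ is implied by `P = PSPACE` (round `acc` exactly), hence
unrefutable outright: a NEGATIVE result can only be a barrier (an oracle / a black-box impossibility of
dither-free rounding), which would itself be informative for the persistence×refresh calculus.
Why it might fail (as a road): C⁺ may be false while X₂ is true (X₂ has the hypothesis
"all total commuting deciders are BPP" to play with; no technique is known that uses it — the classical
analogue is Goldreich's open problem).

THE LINE (2 content stubs + 1 sibling-piece stub, composed WITHOUT hypotheses by `CommutingPromiseLift_of` /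
`CommutingWitness_of`, kernel-checked):
* `stub_totalize` (OPEN; L–XL; the load-bearing stub = C⁺ above).
* `stub_restrict` (KNOWN, XS–S: `L ∈ BPP`, `Q.yes ⊆ L`, `Q.no ⊆ Lᶜ` ⟹ `Q ∈ PromiseBPP'`; tree
  `PromiseBPP_subset_PromiseBPP'_holds` + `mem_promiseLift_iff`; kept as a named stub only so that the
  composition is kernel-checked against the exact restriction shape the line needs).
Costume / shred self-check: `stub_totalize` contains no complexity class at all (neither BPP nor
PromiseBPP'), so it restates neither X₂, X, nor the summit; `stub_restrict` is classical and known.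
BC3 probes (stub → X₂, stub → S) in `bc/stub_probes_X2.lean`.  Disproof used: none exists for this crux yet.
-/

noncomputable section

namespace Summit.QuantumAdvantage.QuantumAdvantage.Theses.CommutingDeciders

open scoped BigOperators Classical Matrix
open Literature.Computability.Cryptography Literature.Computability.Complexity

-- ⟨PIECE-DEF: identical text to Sketch.lean / children.json (gen.py); REMOVED after the split⟩
/-- X₁ — COMMUTING PROMISE WITNESS (the sibling piece; used only in `CommutingWitness_of` below). -/
def CommutingPromiseWitness : Prop :=
  ∃ Q : PromiseProblem, Q ∉ PromiseBPP' ∧ ∃ (W : List Bool → ℕ) (D : (x : List Bool) → QCircuit iqpDiag (W x)) (A : Language Bool), A ∈ Classes.P ∧ PolyTimeComputable (id : List Bool → List Bool) (QCircuit.sigmaEncode (G := iqpDiag)) (fun x => (⟨W x, 0, D x⟩ : Σ n m : ℕ, QCircuit iqpDiag (n + m))) ∧ (∀ x ∈ Q.yes, (2 / 3 : ℝ) ≤ ∑ w : QReg (W x), (if boolPair x (List.ofFn w) ∈ A then ‖(iqpUnitary (D x) *ᵥ basisState (fun _ => false)) w‖ ^ 2 else 0)) ∧ (∀ x ∈ Q.no,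 ∑ w : QReg (W x), (if boolPair x (List.ofFn w) ∈ A then ‖(iqpUnitary (D x) *ᵥ basisState (fun _ => false)) w‖ ^ 2 else 0) ≤ (1 / 3 : ℝ))

/-- X₂ — COMMUTING PROMISE→LANGUAGE LIFT (piece of the split of `CommutingWitness`). -/
def CommutingPromiseLift : Prop :=
  (∀ L : Language Bool, (∃ (W : List Bool → ℕ) (D : (x : List Bool) → QCircuit iqpDiag (W x)) (A : Language Bool), A ∈ Classes.P ∧ PolyTimeComputable (id : List Bool → List Bool) (QCircuit.sigmaEncode (G := iqpDiag)) (fun x => (⟨W x, 0, D x⟩ : Σ n m : ℕ, QCircuit iqpDiag (n + m))) ∧ ∀ x : List Bool, (x ∈ L → (2 / 3 : ℝ) ≤ ∑ w : QReg (W x), (if boolPair x (List.ofFn w) ∈ A then ‖(iqpUnitary (D x) *ᵥ basisState (fun _ => false)) w‖ ^ 2 else 0)) ∧ (x ∉ L → ∑ w : QReg (W x), (if boolPair x (List.ofFn w) ∈ A then ‖(iqpUnitary (D x) *ᵥ basisState (fun _ => false)) w‖ ^ 2 else 0) ≤ (1 / 3 : ℝ))) → L ∈ BPP) → ∀ Q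 : PromiseProblem, (∃ (W : List Bool → ℕ) (D : (x : List Bool) → QCircuit iqpDiag (W x)) (A : Language Bool), A ∈ Classes.P ∧ PolyTimeComputable (id : List Bool → List Bool) (QCircuit.sigmaEncode (G := iqpDiag)) (fun x => (⟨W x, 0, D x⟩ : Σ n m : ℕ, QCircuit iqpDiag (n + m))) ∧ (∀ x ∈ Q.yes, (2 / 3 : ℝ) ≤ ∑ w : QReg (W x), (if boolPair x (List.ofFn w) ∈ A then ‖(iqpUnitary (D x) *ᵥ basisState (fun _ => false)) w‖ ^ 2 else 0)) ∧ (∀ x ∈ Q.no, ∑ w : QReg (W x), (if boolPair x (List.ofFn w) ∈ A then ‖(iqpUnitary (D x) *ᵥ basisState (fun _ => false)) w‖ ^ 2 else 0) ≤ (1 / 3 : ℝ))) → Q ∈ PromiseBPP'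
-- ⟨/PIECE-DEF⟩

end Summit.QuantumAdvantage.QuantumAdvantage.Theses.CommutingDeciders

namespace Summit.QuantumAdvantage.QuantumAdvantage.Cruxes.CommutingWitness.Totalize

open scoped BigOperators Classical Matrix
open Literature.Computability.Cryptography Literature.Computability.Complexity
open Summit.QuantumAdvantage.QuantumAdvantage.Theses.CommutingDeciders

/-- **stub_totalize** (OPEN; the transfer C⁺). Every promise problem with a one-shot commuting
promise-decider is separated by a LANGUAGE with a one-shot commuting decider (total 2/3-vs-1/3 gap). -/
theorem stub_totalize :
    ∀ Q : PromiseProblem, (∃ (W : List Bool → ℕ) (D : (x : List Bool) → QCircuit iqpDiag (W x)) (A : Language Bool), A ∈ Classes.P ∧ PolyTimeComputable (id : List Bool → List Bool) (QCircuit.sigmaEncode (G := iqpDiag)) (fun x => (⟨W x, 0, D x⟩ : Σ n m : ℕ, QCircuit iqpDiag (n + m))) ∧ (∀ x ∈ Q.yes, (2 / 3 : ℝ) ≤ ∑ w : QReg (W x), (if boolPair x (List.ofFn w) ∈ A then ‖(iqpUnitary (D x) *ᵥ basisState (fun _ => false)) w‖ ^ 2 else 0)) ∧ (∀ x ∈ Q.no,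 ∑ w : QReg (W x), (if boolPair x (List.ofFn w) ∈ A then ‖(iqpUnitary (D x) *ᵥ basisState (fun _ => false)) w‖ ^ 2 else 0) ≤ (1 / 3 : ℝ))) →
      ∃ L : Language Bool, (∃ (W' : List Bool → ℕ) (D' : (x : List Bool) → QCircuit iqpDiag (W' x)) (A' : Language Bool), A' ∈ Classes.P ∧ PolyTimeComputable (id : List Bool → List Bool) (QCircuit.sigmaEncode (G := iqpDiag)) (fun x => (⟨W' x, 0, D' x⟩ : Σ n m : ℕ, QCircuit iqpDiag (n + m))) ∧ ∀ x : List Bool, (x ∈ L → (2 / 3 : ℝ) ≤ ∑ w : QReg (W' x), (if boolPair x (List.ofFn w) ∈ A' then ‖(iqpUnitary (D' x) *ᵥ basisState (fun _ => false)) w‖ ^ 2 else 0)) ∧ (x ∉ L → ∑ w : QReg (W' x), (if boolPair x (List.ofFn w) ∈ A' then ‖(iqpUnitary (D' x) *ᵥ basisState (fun _ => false)) w‖ ^ 2 else 0) ≤ (1 / 3 : ℝ))) ∧ Q.yes ≤ L ∧ Q.no ≤ Lᶜ := by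
  sorry

/-- **stub_restrict** (KNOWN; restriction of a BPP language to a sub-promise is textbook promise-BPP:
`PromiseBPP ⊆ PromiseBPP'`). -/
theorem stub_restrict :
    ∀ (L : Language Bool) (Q : PromiseProblem), L ∈ BPP → Q.yes ≤ L → Q.no ≤ Lᶜ → Q ∈ PromiseBPP' := by
  sorry

/-- **stub_promiseWitness** — the SIBLING PIECE X₁ (`CommutingPromiseWitness`), an item of the route after the split,
with its own registered line `Lines/promise_sign.lean`; declared here as a stub ONLY so that this line concludes the
registered crux `CommutingWitness` by name before the split is applied (afterwards deleted; X₁ then enters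
`CommutingWitness_of` as the route item, by name). Not part of this line's content. -/
theorem stub_promiseWitness : CommutingPromiseWitness := by
  sorry

/-- COMPOSITION, piece level (kernel-checked, no sorry of its own, no hypotheses): totalization + restriction give
the piece X₂ BY NAME. -/
theorem CommutingPromiseLift_of : CommutingPromiseLift := by
  intro hall Q hQ
  obtain ⟨L, hdecL, hy, hn⟩ := stub_totalize Q hQ
  exact stub_restrict L Q (hall L hdecL) hy hn

/-- COMPOSITION, crux level (kernel-checked, no sorry of its own, no hypotheses): with the sibling piece, the line
reaches the REGISTERED crux `CommutingDeciders.CommutingWitness` BY NAME (the split glue `X₁ → X₂ → X`, inlined). -/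
theorem CommutingWitness_of :
    Summit.QuantumAdvantage.QuantumAdvantage.Theses.CommutingDeciders.CommutingWitness := by
  have h₁ : CommutingPromiseWitness := stub_promiseWitness
  have h₂ : CommutingPromiseLift := CommutingPromiseLift_of
  by_contra hX
  obtain ⟨Q, hQ, hdecQ⟩ := h₁
  refine hQ (h₂ ?_ Q hdecQ)
  intro L hL
  by_contra hBPP
  exact hX ⟨L, hBPP, hL⟩

/-- Sanity (not a stub): `stub_restrict` is indeed known — a 3-line proof from the tree
(`PromiseBPP_subset_PromiseBPP'_holds`).  Kept OUT of the composition so the restriction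
shape stays a named stub; a prover closes `stub_restrict` by `exact restrict_known`. -/
theorem restrict_known :
    ∀ (L : Language Bool) (Q : PromiseProblem), L ∈ BPP → Q.yes ≤ L → Q.no ≤ Lᶜ → Q ∈ PromiseBPP' := by
  intro L Q hL hy hn
  exact PromiseBPP_subset_PromiseBPP'_holds ⟨L, hL, hy, hn⟩

end Summit.QuantumAdvantage.QuantumAdvantage.Cruxes.CommutingWitness.Totalize
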